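import Literature.Barriers.CriticalPhenomena.IsingTrivialityFromDimensionFour
import Literature.Probability.LatticeModels.WeightedTreeBoundCorrelations

/-!
# Discharge of `treeDiagramBound`: Aizenman's tree diagram bound on any finite graph

Sibling of `Literature/Barriers/CriticalPhenomena/IsingTrivialityFromDimensionFour.lean` (barrier catalogue
D-0021, sub-problem `Ising3DConformalLimit`), which vendors as the named fact `treeDiagramBound` the tree
diagram bound of Aizenman 1982 as printed in Aizenman, CDM 2020, Lemma 8.1 / eq. (8.2): "for the Ising model
on any finite graph, at `h = 0` and `β ≥ 0` … `|U₄(x₁,…,x₄)| ≤ 2 Σ_u ⟨σ_uσ_{x₁}⟩⟨σ_uσ_{x₂}⟩⟨σ_uσ_{x₃}⟩⟨σ_uσ_{x₄}⟩`"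
(unit couplings, free boundary condition, `U₄ = connectedFour`), the finite-graph input of
`Literature/Probability/LatticeModels/HighDimTrivialityTreeBound.lean` (crit-ising.S13).

This file PROVES it (`treeDiagramBound_holds`): the uniform coupling `β` is the constant edge weight
`K ≡ β` of the weighted random-current formalism (`Literature.Probability.LatticeModels.currentSum_eq_wcurrentSum`),
the free correlations are the current-sum ratios (`isingTwoPoint_free_eq_currentSum_div_holds`,
`isingExpect_spinMonomial_four_eq` of `RandomCurrentsProofs` / `UrsellFourCurrentsProofs`), and the bound
is `Literature.Probability.LatticeModels.abs_ursell_ratio_le` (switching lemma, conditioning on the cluster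
of `x₁`, Simon-type restricted-volume bound; `WeightedTreeBound*.lean`).

## References

* M. Aizenman, in *Current Developments in Mathematics 2020*, arXiv:2112.04248, Lemma 8.1 and eq. (8.2)
  [AizenmanCDM2020]; M. Aizenman, Comm. Math. Phys. 86 (1982) [AizenmanCMP1982].
-/

noncomputable section

namespace Literature.Barriers.CriticalPhenomena

open Literature.Probability.LatticeModels Finset
open scoped symmDiff

/-- **Discharge of the named fact `treeDiagramBound`** (Aizenman 1982; Aizenman CDM 2020, Lemma 8.1,
eq. (8.2)): for the Ising model with unit couplings on any finite simple graph, free boundary condition,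
`h = 0`, `β ≥ 0`, and any `x : Fin 4 → V`,
`|U₄(x)| ≤ 2 ∑_u ∏ⱼ ⟨σ_uσ_{xⱼ}⟩`. [cite: AizenmanCDM2020, Lemma 8.1 and eq. (8.2)] -/
theorem treeDiagramBound_holds : treeDiagramBound := by
  intro V _ _ G _ β hβ x
  have hK : ∀ e : G.edgeFinset, 0 ≤ (fun _ : G.edgeFinset => β) e := fun _ => hβ
  have h := abs_ursell_ratio_le (G := G) (K := fun _ : G.edgeFinset => β) hK (x 0) (x 1) (x 2) (x 3)
  -- the four-point function
  have hmono : spinMonomial x = spinMonomial ![x 0, x 1, x 2, x 3] := by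
    funext σ
    simp [spinMonomial, Fin.prod_univ_four]
  have h4 : nPoint (isingMeasure G univ β 0 .free) spinAt x =
      wcurrentSum (fun _ : G.edgeFinset => β) ({x 0} ∆ ({x 1} ∆ ({x 2} ∆ {x 3}))) /
        wcurrentSum (fun _ : G.edgeFinset => β) ∅ := by
    rw [nPoint_isingMeasure, hmono, isingExpect_spinMonomial_four_eq, currentSum_eq_wcurrentSum,
      currentSum_eq_wcurrentSum]
  -- the two-point functions
  have h2 : ∀ a b : V, isingTwoPoint G univ β 0 .free a b =
      wcurrentSum (fun _ : G.edgeFinset => β) ({a} ∆ {b}) / wcurrentSum (fun _ : G.edgeFinset => β) ∅ := by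
    intro a b
    rw [isingTwoPoint_free_eq_currentSum_div_holds, currentSum_eq_wcurrentSum, currentSum_eq_wcurrentSum]
  have h2' : ∀ a b : V, twoPoint (isingMeasure G univ β 0 .free) spinAt a b =
      wcurrentSum (fun _ : G.edgeFinset => β) ({a} ∆ {b}) / wcurrentSum (fun _ : G.edgeFinset => β) ∅ := by
    intro a b
    rw [twoPoint_isingMeasure, h2]
  rw [connectedFour, h4, h2', h2', h2', h2', h2', h2']
  refine h.trans (le_of_eq ?_)
  congr 1
  refine Finset.sum_congr rfl fun u _ => ?_
  rw [Fin.prod_univ_four, h2, h2, h2, h2, symmDiff_comm ({u} : Finset V) {x 0},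
    symmDiff_comm ({u} : Finset V) {x 1}, symmDiff_comm ({u} : Finset V) {x 2},
    symmDiff_comm ({u} : Finset V) {x 3}]

end Literature.Barriers.CriticalPhenomena

end
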